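import Mathlib
import Summits.Ventures.PercRepro2.TypedPendantRoot

/-!
# Typed-base reductions: the PENDANT ROOT `a₂` — the mirror of `TypedPendantRoot` (blind cell
PercRepro2, mine-2 g50, 2026-08-29; `conjectures/MINE-2.md` M2-106)

The typed root-leaf identity `typedCount_pendant_a2` (`TypedPendantRoot`) in its three-placement
forms for `τ f = 1, 2` and, by the copy symmetry of the typed count, as ONE kernel each:
**`KA2one`** (the copy with `a₂` attached placed in each slot, the other two with `a₂` isolated)
and **`KA2two`** (`typedCount_pendant_a2_eq_KA2one / _KA2two`) — the same statements as at `a₁`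
with `killA2` / `KBk2`.  Own work; standard axioms.
-/

namespace Summit.Ventures.PercRepro2

namespace CovForm

namespace TypedRed

open OneTyped TypedA3

/-! ## The kernels -/

section Kernels

/-- **The type-`1` pendant-root kernel at `a₂`**: the copy `x` has `a₂` attached, placed in each of
the three slots; `y, w` have `a₂` isolated. -/
def KA2one (x y w : St) : ℤ :=
  KB x (killA2 y) (killA2 w) + KB (killA2 y) x (killA2 w) + KB (killA2 y) (killA2 w) x

/-- **The type-`2` pendant-root kernel at `a₂`**: the copy `x` has `a₂` isolated, placed in each
of the three slots; `y, w` have `a₂` attached. -/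
def KA2two (x y w : St) : ℤ :=
  KB (killA2 x) y w + KB y (killA2 x) w + KB y w (killA2 x)

end Kernels

/-! ## The three placements -/

section Identity

variable {V : Type*} {E : Type*} [Fintype E] [DecidableEq E] {R : Type*} [Field R]
variable (ends : E → Sym2 V) (o a₁ a₂ a₃ b : V)

/-- The three placements for `τ f = 1`: the open copy in each slot. -/
theorem typedCount_pendant_a2_one {f : E} {u : V} (hf : ends f = s(a₂, u))
    (hleaf : ∀ e, a₂ ∈ ends e → e = f) (h2u : a₂ ≠ u) (h2o : a₂ ≠ o) (h21 : a₂ ≠ a₁)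
    (h23 : a₂ ≠ a₃) (h2b : a₂ ≠ b) (F : Finset E) (hfF : f ∈ F) (z : Config E) (τ : E → ℕ)
    (hτ : τ f = 1) :
    typedCount F z τ (K3 ends o a₁ a₂ a₃ b : Config E → Config E → Config E → R) =
      typedCount (F.erase f) (Function.update z f false) τ
          (fun x y w => ((KBk2 true false false (st ends o a₁ a₂ a₃ b (Function.update x f true))
            (st ends o a₁ a₂ a₃ b (Function.update y f true))
            (st ends o a₁ a₂ a₃ b (Function.update w f true)) : ℤ) : R)) +
        typedCount (F.erase f) (Function.update z f false) τ
          (fun x y w => ((KBk2 false true false (st ends o a₁ a₂ a₃ b (Function.update x f true))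
            (st ends o a₁ a₂ a₃ b (Function.update y f true))
            (st ends o a₁ a₂ a₃ b (Function.update w f true)) : ℤ) : R)) +
        typedCount (F.erase f) (Function.update z f false) τ
          (fun x y w => ((KBk2 false false true (st ends o a₁ a₂ a₃ b (Function.update x f true))
            (st ends o a₁ a₂ a₃ b (Function.update y f true))
            (st ends o a₁ a₂ a₃ b (Function.update w f true)) : ℤ) : R)) := by
  rw [typedCount_pendant_a2 ends o a₁ a₂ a₃ b hf hleaf h2u h2o h21 h23 h2b F hfF z τ]
  simp only [Fintype.sum_bool, Bool.toNat_true, Bool.toNat_false, hτ]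
  norm_num
  ring

/-- The three placements for `τ f = 2`: the closed copy in each slot. -/
theorem typedCount_pendant_a2_two {f : E} {u : V} (hf : ends f = s(a₂, u))
    (hleaf : ∀ e, a₂ ∈ ends e → e = f) (h2u : a₂ ≠ u) (h2o : a₂ ≠ o) (h21 : a₂ ≠ a₁)
    (h23 : a₂ ≠ a₃) (h2b : a₂ ≠ b) (F : Finset E) (hfF : f ∈ F) (z : Config E) (τ : E → ℕ)
    (hτ : τ f = 2) :
    typedCount F z τ (K3 ends o a₁ a₂ a₃ b : Config E → Config E → Config E → R) =
      typedCount (F.erase f) (Function.update z f false) τ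
          (fun x y w => ((KBk2 false true true (st ends o a₁ a₂ a₃ b (Function.update x f true))
            (st ends o a₁ a₂ a₃ b (Function.update y f true))
            (st ends o a₁ a₂ a₃ b (Function.update w f true)) : ℤ) : R)) +
        typedCount (F.erase f) (Function.update z f false) τ
          (fun x y w => ((KBk2 true false true (st ends o a₁ a₂ a₃ b (Function.update x f true))
            (st ends o a₁ a₂ a₃ b (Function.update y f true))
            (st ends o a₁ a₂ a₃ b (Function.update w f true)) : ℤ) : R)) +
        typedCount (F.erase f) (Function.update z f false) τ
          (fun x y w => ((KBk2 true true false (st ends o a₁ a₂ a₃ b (Function.update x f true))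
            (st ends o a₁ a₂ a₃ b (Function.update y f true))
            (st ends o a₁ a₂ a₃ b (Function.update w f true)) : ℤ) : R)) := by
  rw [typedCount_pendant_a2 ends o a₁ a₂ a₃ b hf hleaf h2u h2o h21 h23 h2b F hfF z τ]
  simp only [Fintype.sum_bool, Bool.toNat_true, Bool.toNat_false, hτ]
  norm_num
  ring

end Identity

/-! ## One kernel per type, by the copy symmetry -/

section OneKernel

variable {V : Type*} {E : Type*} [Fintype E] [DecidableEq E] {R : Type*} [Field R]
variable (ends : E → Sym2 V) (o a₁ a₂ a₃ b : V)

/-- **Type `1` pendant root, one kernel**: the typed count is the typed count on `G − a₂` of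
`KA2one` (types in `{1, 2}` on `F`). -/
theorem typedCount_pendant_a2_eq_KA2one {f : E} {u : V} (hf : ends f = s(a₂, u))
    (hleaf : ∀ e, a₂ ∈ ends e → e = f) (h2u : a₂ ≠ u) (h2o : a₂ ≠ o) (h21 : a₂ ≠ a₁)
    (h23 : a₂ ≠ a₃) (h2b : a₂ ≠ b) (F : Finset E) (hfF : f ∈ F) (z : Config E) (τ : E → ℕ)
    (hτF : ∀ e ∈ F, τ e = 1 ∨ τ e = 2) (hτ : τ f = 1) :
    typedCount F z τ (K3 ends o a₁ a₂ a₃ b : Config E → Config E → Config E → R) =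
      typedCount (F.erase f) (Function.update z f false) τ
        (fun x y w => ((KA2one (st ends o a₁ a₂ a₃ b (Function.update x f true))
          (st ends o a₁ a₂ a₃ b (Function.update y f true))
          (st ends o a₁ a₂ a₃ b (Function.update w f true)) : ℤ) : R)) := by
  set S := fun x : Config E => st ends o a₁ a₂ a₃ b (Function.update x f true) with hS
  have hτ' : ∀ e ∈ F.erase f, τ e = 1 ∨ τ e = 2 := fun e he => hτF e (Finset.mem_of_mem_erase he)
  rw [typedCount_pendant_a2_one ends o a₁ a₂ a₃ b hf hleaf h2u h2o h21 h23 h2b F hfF z τ hτ]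
  have t2 : typedCount (F.erase f) (Function.update z f false) τ
      (fun x y w => ((KBk2 false true false (S x) (S y) (S w) : ℤ) : R)) =
      typedCount (F.erase f) (Function.update z f false) τ
        (fun x y w => ((KB (killA2 (S y)) (S x) (killA2 (S w)) : ℤ) : R)) := by
    rw [← typedCount_swap12 (F.erase f) (Function.update z f false) τ
      (fun x y w => ((KB (killA2 (S y)) (S x) (killA2 (S w)) : ℤ) : R))]
    rfl
  have t3 : typedCount (F.erase f) (Function.update z f false) τ
      (fun x y w => ((KBk2 false false true (S x) (S y) (S w) : ℤ) : R)) =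
      typedCount (F.erase f) (Function.update z f false) τ
        (fun x y w => ((KB (killA2 (S y)) (killA2 (S w)) (S x) : ℤ) : R)) := by
    have s1 := typedCount_swap13 (F.erase f) (Function.update z f false) τ hτ'
      (fun x y w => ((KB (killA2 (S w)) (killA2 (S y)) (S x) : ℤ) : R))
    have s2 := typedCount_swap23 (F.erase f) (Function.update z f false) τ hτ'
      (fun x y w => ((KB (killA2 (S y)) (killA2 (S w)) (S x) : ℤ) : R))
    rw [← s2, ← s1]
    rfl
  rw [t2, t3, ← typedCount_add', ← typedCount_add']
  refine typedCount_congr_K _ _ _ fun x y w => ?_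
  unfold KA2one KBk2
  push_cast
  rfl

/-- **Type `2` pendant root, one kernel**: the typed count is the typed count on `G − a₂` of
`KA2two` (types in `{1, 2}` on `F`). -/
theorem typedCount_pendant_a2_eq_KA2two {f : E} {u : V} (hf : ends f = s(a₂, u))
    (hleaf : ∀ e, a₂ ∈ ends e → e = f) (h2u : a₂ ≠ u) (h2o : a₂ ≠ o) (h21 : a₂ ≠ a₁)
    (h23 : a₂ ≠ a₃) (h2b : a₂ ≠ b) (F : Finset E) (hfF : f ∈ F) (z : Config E) (τ : E → ℕ)
    (hτF : ∀ e ∈ F, τ e = 1 ∨ τ e = 2) (hτ : τ f = 2) :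
    typedCount F z τ (K3 ends o a₁ a₂ a₃ b : Config E → Config E → Config E → R) =
      typedCount (F.erase f) (Function.update z f false) τ
        (fun x y w => ((KA2two (st ends o a₁ a₂ a₃ b (Function.update x f true))
          (st ends o a₁ a₂ a₃ b (Function.update y f true))
          (st ends o a₁ a₂ a₃ b (Function.update w f true)) : ℤ) : R)) := by
  set S := fun x : Config E => st ends o a₁ a₂ a₃ b (Function.update x f true) with hS
  have hτ' : ∀ e ∈ F.erase f, τ e = 1 ∨ τ e = 2 := fun e he => hτF e (Finset.mem_of_mem_erase he)
  rw [typedCount_pendant_a2_two ends o a₁ a₂ a₃ b hf hleaf h2u h2o h21 h23 h2b F hfF z τ hτ]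
  have t2 : typedCount (F.erase f) (Function.update z f false) τ
      (fun x y w => ((KBk2 true false true (S x) (S y) (S w) : ℤ) : R)) =
      typedCount (F.erase f) (Function.update z f false) τ
        (fun x y w => ((KB (S y) (killA2 (S x)) (S w) : ℤ) : R)) := by
    rw [← typedCount_swap12 (F.erase f) (Function.update z f false) τ
      (fun x y w => ((KB (S y) (killA2 (S x)) (S w) : ℤ) : R))]
    rfl
  have t3 : typedCount (F.erase f) (Function.update z f false) τ
      (fun x y w => ((KBk2 true true false (S x) (S y) (S w) : ℤ) : R)) =
      typedCount (F.erase f) (Function.update z f false) τ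
        (fun x y w => ((KB (S y) (S w) (killA2 (S x)) : ℤ) : R)) := by
    have s1 := typedCount_swap13 (F.erase f) (Function.update z f false) τ hτ'
      (fun x y w => ((KB (S w) (S y) (killA2 (S x)) : ℤ) : R))
    have s2 := typedCount_swap23 (F.erase f) (Function.update z f false) τ hτ'
      (fun x y w => ((KB (S y) (S w) (killA2 (S x)) : ℤ) : R))
    rw [← s2, ← s1]
    rfl
  rw [t2, t3, ← typedCount_add', ← typedCount_add']
  refine typedCount_congr_K _ _ _ fun x y w => ?_
  unfold KA2two KBk2
  push_cast
  rfl

end OneKernel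

end TypedRed

end CovForm

end Summit.Ventures.PercRepro2
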